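import Literature.Computability.AlgebraicComplexity.LaserValue
import Literature.Computability.AlgebraicComplexity.GroupAlgebraTensor
import HarnessLib

/-!
# The value of a tensor is supermultiplicative: `V_ρ(t ⊗ t') ≥ V_ρ(t) · V_ρ(t')` — proved

Topic `Literature/Computability/AlgebraicComplexity`; companion of `LaserValue.lean` (the predicate
`HasLaserValue ρ t v`, "`V_ρ(t) ≥ v`", with explicit degeneration witnesses
`t^{⊗N} ⊵ ⊕ᵢ ⟨kᵢ,mᵢ,nᵢ⟩`, `v^N ≤ (1+ε)^N ∑ (kᵢmᵢnᵢ)^{ρ/3}`).  Coppersmith–Winograd 1990 (§8) and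
Le Gall 2014 (§2.2: "the value is superadditive and supermultiplicative") USE, without proof, the
closure of the value under tensor products; the laser method with values (Le Gall 2014, Thm. 4.1;
BCS 1997 §15.8 for matrix components) needs it in the `N`-ary form "the block
`⊗_ρ t(x_ρ, y_ρ, z_ρ)` of `t^{⊗N}` has value `≥ ∏_ρ V_ρ(t(x_ρ,y_ρ,z_ρ))`".  This file PROVES:

* `tensorRestrictsTo_kronecker_matMulDirectSum` — the Kronecker product of two direct sums of
  matrix tensors restricts to (indeed is isomorphic to) the direct sum of the products of the
  blocks, `(⊕ᵢ ⟨kᵢ,mᵢ,nᵢ⟩) ⊗ (⊕_{i'} ⟨k'_{i'},m'_{i'},n'_{i'}⟩) ≥ ⊕_{(i,i')} ⟨kᵢk'_{i'}, mᵢm'_{i'}, nᵢn'_{i'}⟩`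
  (formats `mulFormats`), with `∑ (vol)^τ = (∑ volᵢ^τ)(∑ vol'_{i'}^τ)` (`sum_rpow_mulFormats`);
  `exists_restrictsTo_kroneckerPow_matMulDirectSum` — hence `(⊕ᵢ ⟨kᵢ,mᵢ,nᵢ⟩)^{⊗N} ≥ ⊕_w ⟨…⟩` with
  `∑ (vol)^τ = (∑ volᵢ^τ)^N` (Bläser 2013, proof of Thm. 7.5: `D^{⊗s} = ⊕_σ … ⊙ ⟨∏ kᵢ^{σᵢ}, …⟩`).
* `HasLaserValue.kronecker` — **`V_ρ(t) ≥ v`, `V_ρ(t') ≥ v'` ⇒ `V_ρ(t ⊗ t') ≥ v v'`** (align the two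
  witnesses at the common power `N N'`: `(t ⊗ t')^{⊗NN'} ≅ (t^{⊗N})^{⊗N'} ⊗ (t'^{⊗N'})^{⊗N}`);
  `HasLaserValue.kroneckerPow` — `V_ρ(t^{⊗n}) ≥ v^n`; `HasLaserValue.of_kroneckerPow` — conversely a
  bound `V_ρ(t^{⊗n}) ≥ w` gives `V_ρ(t) ≥ w^{1/n}`; `HasLaserValue.kroneckerPi` — the `N`-ary form for
  a family of tensors of one format, `V_ρ(⊗_l T_l) ≥ ∏_l v_l`.
* `hasLaserValue_zero`, `hasLaserValue_one_kroneckerPi_zero` (the empty product `≅ ⟨1,1,1⟩` has value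
  `≥ 1`), and the closure of the predicate under limits from below, `hasLaserValue_of_forall_lt`
  (`V_ρ(t) ≥ v'` for all `v' < v` ⇒ `V_ρ(t) ≥ v`), which the laser method uses to pass from rational
  to real distributions and to let `N → ∞`.

Everything is proved; one auxiliary definition (`mulFormats`), no named facts.

## References

* F. Le Gall, *Powers of tensors and fast matrix multiplication*, ISSAC 2014, arXiv:1401.7714,
  §2.2 ("the value is superadditive and supermultiplicative"). [LeGall2014]
* D. Coppersmith, S. Winograd, *Matrix multiplication via arithmetic progressions*, J. Symbolic
  Comput. 9 (1990) 251–280, §8 (values of the components of `CW_q^{⊗2}`, "the value is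
  supermultiplicative"). [CoppersmithWinograd1990]
* M. Bläser, *Fast Matrix Multiplication*, ToC Graduate Surveys 5 (2013), proof of Thm. 7.5
  (powers of a direct sum of matrix tensors), §9.4. [Blaser2013]
-/

noncomputable section

open scoped BigOperators
open Finset Filter Topology

namespace Literature.Computability.AlgebraicComplexity

open Literature.Barriers.MatrixMultiplication (PolyDegeneratesTo PolyDegeneratesTo.trans
  PolyDegeneratesTo.kronecker PolyDegeneratesTo.kroneckerPow tensorRestrictsTo_kroneckerPow_mul
  tensorRestrictsTo_kroneckerPow_of_eq kroneckerTensor_kroneckerPow_eq)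

universe u

/-! ## `ε`-bookkeeping -/

section Eps

/-- For `ε > 0` there is `0 < η ≤ 1` with `(1+η)² ≤ 1+ε` (`η = min(1, ε/3)`). [folklore] -/
theorem exists_pos_mul_self_le_one_add {ε : ℝ} (hε : 0 < ε) :
    ∃ η : ℝ, 0 < η ∧ η ≤ 1 ∧ (1 + η) * (1 + η) ≤ 1 + ε := by
  refine ⟨min 1 (ε / 3), lt_min one_pos (by positivity), min_le_left _ _, ?_⟩
  have h1 : min 1 (ε / 3) ≤ 1 := min_le_left _ _
  have h2 : min 1 (ε / 3) ≤ ε / 3 := min_le_right _ _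
  have h0 : 0 ≤ min 1 (ε / 3) := le_min zero_le_one (by positivity)
  nlinarith

/-- For `ε > 0` and `n ∈ ℕ` there is `η > 0` with `(1+η)^n ≤ 1+ε`. [folklore] -/
theorem exists_pos_one_add_pow_le {ε : ℝ} (hε : 0 < ε) (n : ℕ) :
    ∃ η : ℝ, 0 < η ∧ (1 + η) ^ n ≤ 1 + ε := by
  induction n generalizing ε with
  | zero => exact ⟨1, one_pos, by rw [pow_zero]; linarith⟩
  | succ n ih =>
    obtain ⟨ε₁, hε₁, -, hε₁ε⟩ := exists_pos_mul_self_le_one_add hε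
    obtain ⟨η₁, hη₁, hη₁n⟩ := ih hε₁
    have h0 : 0 < min η₁ ε₁ := lt_min hη₁ hε₁
    refine ⟨min η₁ ε₁, h0, ?_⟩
    have hle : (1 + min η₁ ε₁) ^ n ≤ 1 + ε₁ :=
      (pow_le_pow_left₀ (by linarith) (by linarith [min_le_left η₁ ε₁]) n).trans hη₁n
    calc (1 + min η₁ ε₁) ^ (n + 1) = (1 + min η₁ ε₁) ^ n * (1 + min η₁ ε₁) := pow_succ _ _
      _ ≤ (1 + ε₁) * (1 + ε₁) :=
          mul_le_mul hle (by linarith [min_le_right η₁ ε₁]) (by linarith) (by linarith)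
      _ ≤ 1 + ε := hε₁ε

end Eps

/-! ## Products and powers of direct sums of matrix tensors -/

section DirectSums

variable (K : Type u) [CommSemiring K]

/-- Formats of the product blocks: block `j ↔ (i, i')` of `Fin (p p')` (via `finProdFinEquiv`) gets
`k i · k' i'`. [folklore] -/
abbrev mulFormats {p p' : ℕ} (k : Fin p → ℕ) (k' : Fin p' → ℕ) : Fin (p * p') → ℕ :=
  fun j => k (finProdFinEquiv.symm j).1 * k' (finProdFinEquiv.symm j).2

/-- **`(⊕ᵢ ⟨kᵢ,mᵢ,nᵢ⟩) ⊗ (⊕_{i'} ⟨k'_{i'},m'_{i'},n'_{i'}⟩) ≥ ⊕_{(i,i')} ⟨kᵢk'_{i'}, mᵢm'_{i'}, nᵢn'_{i'}⟩`**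
(relabelling: the digits of a matrix index of the product block are matrix indices of the two
factor blocks; mixed block pairs vanish on both sides; `⟨k,m,n⟩ ⊗ ⟨k',m',n'⟩ ≅ ⟨kk',mm',nn'⟩`,
Bläser 2013 §7). [cite: Blaser2013, §7] -/
theorem tensorRestrictsTo_kronecker_matMulDirectSum {p p' : ℕ} (k m n : Fin p → ℕ)
    (k' m' n' : Fin p' → ℕ) :
    TensorRestrictsTo (kroneckerTensor (matMulDirectSum K k m n) (matMulDirectSum K k' m' n'))
      (matMulDirectSum K (mulFormats k k') (mulFormats m m') (mulFormats n n')) := by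
  classical
  -- notation: `e j = (i, i')`, and the digit maps of the product formats
  set e : Fin (p * p') → Fin p × Fin p' := fun j => finProdFinEquiv.symm j with he
  have einj : Function.Injective e := fun j j' h => finProdFinEquiv.symm.injective h
  -- index maps
  let F₁ : (Σ j : Fin (p * p'), Fin (mulFormats k k' j) × Fin (mulFormats n n' j)) →
      (Σ i : Fin p, Fin (k i) × Fin (n i)) × (Σ i' : Fin p', Fin (k' i') × Fin (n' i')) :=
    fun a => (⟨(e a.1).1, ((finProdFinEquiv.symm a.2.1).1, (finProdFinEquiv.symm a.2.2).1)⟩,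
      ⟨(e a.1).2, ((finProdFinEquiv.symm a.2.1).2, (finProdFinEquiv.symm a.2.2).2)⟩)
  let F₂ : (Σ j : Fin (p * p'), Fin (mulFormats k k' j) × Fin (mulFormats m m' j)) →
      (Σ i : Fin p, Fin (k i) × Fin (m i)) × (Σ i' : Fin p', Fin (k' i') × Fin (m' i')) :=
    fun b => (⟨(e b.1).1, ((finProdFinEquiv.symm b.2.1).1, (finProdFinEquiv.symm b.2.2).1)⟩,
      ⟨(e b.1).2, ((finProdFinEquiv.symm b.2.1).2, (finProdFinEquiv.symm b.2.2).2)⟩)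
  let F₃ : (Σ j : Fin (p * p'), Fin (mulFormats m m' j) × Fin (mulFormats n n' j)) →
      (Σ i : Fin p, Fin (m i) × Fin (n i)) × (Σ i' : Fin p', Fin (m' i') × Fin (n' i')) :=
    fun c => (⟨(e c.1).1, ((finProdFinEquiv.symm c.2.1).1, (finProdFinEquiv.symm c.2.2).1)⟩,
      ⟨(e c.1).2, ((finProdFinEquiv.symm c.2.1).2, (finProdFinEquiv.symm c.2.2).2)⟩)
  have key : matMulDirectSum K (mulFormats k k') (mulFormats m m') (mulFormats n n') =
      fun a b c => kroneckerTensor (matMulDirectSum K k m n) (matMulDirectSum K k' m' n')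
        (F₁ a) (F₂ b) (F₃ c) := by
    funext a b c
    obtain ⟨ja, x, z⟩ := a
    obtain ⟨jb, x', y⟩ := b
    obtain ⟨jc, y', z'⟩ := c
    rw [kroneckerTensor_apply]
    by_cases H : ja = jb ∧ jb = jc
    · obtain ⟨rfl, rfl⟩ := H
      -- inside one block: digit equalities
      have hx : ((x : ℕ) = x') ↔ (((finProdFinEquiv.symm x).1 : ℕ) = (finProdFinEquiv.symm x').1 ∧
          ((finProdFinEquiv.symm x).2 : ℕ) = (finProdFinEquiv.symm x').2) := by
        rw [Fin.val_inj, Fin.val_inj, Fin.val_inj, ← Prod.ext_iff, Equiv.apply_eq_iff_eq]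
      have hy : ((y : ℕ) = y') ↔ (((finProdFinEquiv.symm y).1 : ℕ) = (finProdFinEquiv.symm y').1 ∧
          ((finProdFinEquiv.symm y).2 : ℕ) = (finProdFinEquiv.symm y').2) := by
        rw [Fin.val_inj, Fin.val_inj, Fin.val_inj, ← Prod.ext_iff, Equiv.apply_eq_iff_eq]
      have hz : ((z : ℕ) = z') ↔ (((finProdFinEquiv.symm z).1 : ℕ) = (finProdFinEquiv.symm z').1 ∧
          ((finProdFinEquiv.symm z).2 : ℕ) = (finProdFinEquiv.symm z').2) := by
        rw [Fin.val_inj, Fin.val_inj, Fin.val_inj, ← Prod.ext_iff, Equiv.apply_eq_iff_eq]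
      simp only [matMulDirectSum, F₁, F₂, F₃, true_and, boole_mul]
      rw [← ite_and]
      refine ite_congr_prop ?_
      rw [hx, hy, hz]
      tauto
    · -- two different blocks: both sides vanish
      have hR : matMulDirectSum K (mulFormats k k') (mulFormats m m') (mulFormats n n') ⟨ja, x, z⟩
          ⟨jb, x', y⟩ ⟨jc, y', z'⟩ = 0 :=
        matMulDirectSum_of_ne K _ _ _ (not_and_or.1 H)
      rw [hR]
      have hblocks : ((e ja).1 = (e jb).1 ∧ (e jb).1 = (e jc).1) →
          ((e ja).2 = (e jb).2 ∧ (e jb).2 = (e jc).2) → False := fun h1 h2 =>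
        H ⟨einj (Prod.ext h1.1 h2.1), einj (Prod.ext h1.2 h2.2)⟩
      by_cases H1 : (e ja).1 = (e jb).1 ∧ (e jb).1 = (e jc).1
      · have h0 : matMulDirectSum K k' m' n' (F₁ ⟨ja, x, z⟩).2 (F₂ ⟨jb, x', y⟩).2 (F₃ ⟨jc, y', z'⟩).2 = 0 :=
          matMulDirectSum_of_ne K _ _ _ (not_and_or.1 fun h2 => hblocks H1 h2)
        rw [h0, mul_zero]
      · have h0 : matMulDirectSum K k m n (F₁ ⟨ja, x, z⟩).1 (F₂ ⟨jb, x', y⟩).1 (F₃ ⟨jc, y', z'⟩).1 = 0 :=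
          matMulDirectSum_of_ne K _ _ _ (not_and_or.1 H1)
        rw [h0, zero_mul]
  rw [key]
  exact tensorRestrictsTo_precomp _ _ _ _

/-- The `τ`-volume sum of the product blocks factors: `∑_{(i,i')} (vol_i vol'_{i'})^τ = (∑ᵢ volᵢ^τ)(∑_{i'} vol'_{i'}^τ)`.
[folklore] -/
theorem sum_rpow_mulFormats {p p' : ℕ} (k m n : Fin p → ℕ) (k' m' n' : Fin p' → ℕ) (τ : ℝ) :
    ∑ j, ((mulFormats k k' j * mulFormats m m' j * mulFormats n n' j : ℕ) : ℝ) ^ τ =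
      (∑ i, ((k i * m i * n i : ℕ) : ℝ) ^ τ) * ∑ i, ((k' i * m' i * n' i : ℕ) : ℝ) ^ τ := by
  have h1 : ∀ j : Fin (p * p'),
      ((mulFormats k k' j * mulFormats m m' j * mulFormats n n' j : ℕ) : ℝ) ^ τ =
        ((k (finProdFinEquiv.symm j).1 * m (finProdFinEquiv.symm j).1 *
            n (finProdFinEquiv.symm j).1 : ℕ) : ℝ) ^ τ *
          ((k' (finProdFinEquiv.symm j).2 * m' (finProdFinEquiv.symm j).2 *
            n' (finProdFinEquiv.symm j).2 : ℕ) : ℝ) ^ τ := by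
    intro j
    rw [← Real.mul_rpow (Nat.cast_nonneg _) (Nat.cast_nonneg _)]
    congr 1
    simp only [mulFormats]
    push_cast
    ring
  simp_rw [h1]
  rw [← Equiv.sum_comp finProdFinEquiv]
  simp only [Equiv.symm_apply_apply]
  rw [Fintype.sum_prod_type, Finset.sum_mul_sum]

/-- **Powers of a direct sum of matrix tensors**: `(⊕ᵢ ⟨kᵢ,mᵢ,nᵢ⟩)^{⊗N}` restricts to a direct sum of
matrix tensors `⊕_j ⟨k'_j, m'_j, n'_j⟩` with `∑_j (k'_j m'_j n'_j)^τ = (∑ᵢ (kᵢmᵢnᵢ)^τ)^N` (the blocks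
`⊗_l ⟨k_{w l}, m_{w l}, n_{w l}⟩ ≅ ⟨∏ k_{w l}, …⟩` over the words `w`; Bläser 2013, proof of Thm. 7.5).
[cite: Blaser2013, Thm. 7.5 (proof)] -/
theorem exists_restrictsTo_kroneckerPow_matMulDirectSum {p : ℕ} (k m n : Fin p → ℕ) (τ : ℝ)
    (N : ℕ) :
    ∃ (P : ℕ) (k' m' n' : Fin P → ℕ),
      TensorRestrictsTo (kroneckerPow (matMulDirectSum K k m n) N) (matMulDirectSum K k' m' n') ∧
        ∑ j, ((k' j * m' j * n' j : ℕ) : ℝ) ^ τ = (∑ i, ((k i * m i * n i : ℕ) : ℝ) ^ τ) ^ N := by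
  classical
  induction N with
  | zero =>
    refine ⟨1, fun _ => 1, fun _ => 1, fun _ => 1, ?_, ?_⟩
    · -- both tensors are the constant `1` on one-point index types
      have key : matMulDirectSum K (fun _ : Fin 1 => 1) (fun _ => 1) (fun _ => 1) = fun a b c =>
          kroneckerPow (matMulDirectSum K k m n) 0 (fun i => Fin.elim0 i) (fun i => Fin.elim0 i)
            (fun i => Fin.elim0 i) := by
        funext a b c
        rw [kroneckerPow_zero]
        obtain ⟨ja, x, z⟩ := a
        obtain ⟨jb, x', y⟩ := b
        obtain ⟨jc, y', z'⟩ := c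
        have h1 := Fin.fin_one_eq_zero ja
        have h2 := Fin.fin_one_eq_zero jb
        have h3 := Fin.fin_one_eq_zero jc
        subst h1 h2 h3
        simp [matMulDirectSum, Fin.val_eq_zero]
      rw [key]
      exact tensorRestrictsTo_precomp _ _ _ _
    · simp
  | succ N ih =>
    obtain ⟨P, k', m', n', hres, hsum⟩ := ih
    refine ⟨p * P, mulFormats k k', mulFormats m m', mulFormats n n', ?_, ?_⟩
    · -- `D^{⊗(N+1)} ≥ D ⊗ D^{⊗N} ≥ D ⊗ (⊕_j …) ≥ ⊕_{(i,j)} …`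
      have h1 : TensorRestrictsTo (kroneckerPow (matMulDirectSum K k m n) (N + 1))
          (kroneckerTensor (matMulDirectSum K k m n) (kroneckerPow (matMulDirectSum K k m n) N)) := by
        rw [kroneckerTensor_kroneckerPow_eq]
        exact tensorRestrictsTo_precomp _ _ _ _
      exact (h1.trans ((TensorRestrictsTo.refl _).kronecker hres)).trans
        (tensorRestrictsTo_kronecker_matMulDirectSum K k m n k' m' n')
    · rw [sum_rpow_mulFormats, hsum, pow_succ']

end DirectSums

/-! ## Supermultiplicativity -/

section Products

variable {K : Type u} [Field K]
variable {ι κ μ ι' κ' μ' : Type*} [Fintype ι] [Fintype κ] [Fintype μ] [Fintype ι'] [Fintype κ']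
  [Fintype μ'] [DecidableEq ι] [DecidableEq κ] [DecidableEq μ] [DecidableEq ι'] [DecidableEq κ']
  [DecidableEq μ']

/-- `(t ⊗ t')^{⊗M} ≥ t^{⊗M} ⊗ t'^{⊗M}` (relabelling). [folklore] -/
theorem tensorRestrictsTo_kroneckerPow_of_kronecker (t : ι → κ → μ → K) (t' : ι' → κ' → μ' → K)
    (M : ℕ) :
    TensorRestrictsTo (kroneckerPow (kroneckerTensor t t') M)
      (kroneckerTensor (kroneckerPow t M) (kroneckerPow t' M)) := by
  rw [kroneckerPow_kroneckerTensor_eq]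
  exact tensorRestrictsTo_of_reindex _ _ _ _

/-- **Supermultiplicativity of the value: `V_ρ(t) ≥ v`, `V_ρ(t') ≥ v'` ⇒ `V_ρ(t ⊗ t') ≥ v v'`**
(`v, v' ≥ 0`).  Witnesses `t^{⊗N} ⊵ D`, `t'^{⊗N'} ⊵ D'` (at a tolerance `η` with `(1+η)² ≤ 1+ε`) give
`(t ⊗ t')^{⊗NN'} ≥ (t^{⊗N})^{⊗N'} ⊗ (t'^{⊗N'})^{⊗N} ⊵ D^{⊗N'} ⊗ D'^{⊗N}`, a direct sum of matrix
tensors with `∑ vol^{ρ/3} = (∑_D)^{N'} (∑_{D'})^{N} ≥ (v v')^{NN'} / (1+η)^{2NN'}`.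
[cite: LeGall2014, §2.2] [cite: CoppersmithWinograd1990, §8] -/
theorem HasLaserValue.kronecker {ρ : ℝ} {t : ι → κ → μ → K} {t' : ι' → κ' → μ' → K} {v v' : ℝ}
    (h : HasLaserValue ρ t v) (h' : HasLaserValue ρ t' v') (hv : 0 ≤ v) (hv' : 0 ≤ v') :
    HasLaserValue ρ (kroneckerTensor t t') (v * v') := by
  classical
  intro ε hε
  obtain ⟨η, hη, -, hηε⟩ := exists_pos_mul_self_le_one_add hε
  obtain ⟨N, hN, p, k, m, n, hdeg, hb⟩ := h η hη
  obtain ⟨N', hN', p', k', m', n', hdeg', hb'⟩ := h' η hη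
  -- powers of the two witnesses
  obtain ⟨P, kk, mm, nn, hres, hsum⟩ :=
    exists_restrictsTo_kroneckerPow_matMulDirectSum K k m n (ρ / 3) N'
  obtain ⟨P', kk', mm', nn', hres', hsum'⟩ :=
    exists_restrictsTo_kroneckerPow_matMulDirectSum K k' m' n' (ρ / 3) N
  refine ⟨N * N', Nat.one_le_iff_ne_zero.2 (Nat.mul_ne_zero (by omega) (by omega)), P * P',
    mulFormats kk kk', mulFormats mm mm', mulFormats nn nn', ?_, ?_⟩
  · -- `t^{⊗(N N')} ≥ (t^{⊗N})^{⊗N'} ⊵ D^{⊗N'} ≥ ⊕ …`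
    have ht : PolyDegeneratesTo (kroneckerPow t (N * N')) (matMulDirectSum K kk mm nn) := by
      have h1 : TensorRestrictsTo (kroneckerPow t (N * N')) (kroneckerPow (kroneckerPow t N) N') :=
        (tensorRestrictsTo_kroneckerPow_of_eq t (Nat.mul_comm N N')).trans
          (tensorRestrictsTo_kroneckerPow_mul t N' N)
      exact (h1.trans_polyDegeneratesTo (hdeg.kroneckerPow N')).trans_restrictsTo hres
    have ht' : PolyDegeneratesTo (kroneckerPow t' (N * N')) (matMulDirectSum K kk' mm' nn') :=
      ((tensorRestrictsTo_kroneckerPow_mul t' N N').trans_polyDegeneratesTo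
        (hdeg'.kroneckerPow N)).trans_restrictsTo hres'
    exact ((tensorRestrictsTo_kroneckerPow_of_kronecker t t' (N * N')).trans_polyDegeneratesTo
      (ht.kronecker ht')).trans_restrictsTo
        (tensorRestrictsTo_kronecker_matMulDirectSum K kk mm nn kk' mm' nn')
  · rw [sum_rpow_mulFormats, hsum, hsum']
    have hS : 0 ≤ ∑ i, ((k i * m i * n i : ℕ) : ℝ) ^ (ρ / 3) :=
      Finset.sum_nonneg fun i _ => Real.rpow_nonneg (Nat.cast_nonneg _) _
    have hS' : 0 ≤ ∑ i, ((k' i * m' i * n' i : ℕ) : ℝ) ^ (ρ / 3) :=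
      Finset.sum_nonneg fun i _ => Real.rpow_nonneg (Nat.cast_nonneg _) _
    have h1 : (v ^ N) ^ N' ≤ ((1 + η) ^ N * ∑ i, ((k i * m i * n i : ℕ) : ℝ) ^ (ρ / 3)) ^ N' :=
      pow_le_pow_left₀ (pow_nonneg hv N) hb N'
    have h2 : (v' ^ N') ^ N ≤ ((1 + η) ^ N' * ∑ i, ((k' i * m' i * n' i : ℕ) : ℝ) ^ (ρ / 3)) ^ N :=
      pow_le_pow_left₀ (pow_nonneg hv' N') hb' N
    have h3 : ((1 + η) * (1 + η)) ^ (N * N') ≤ (1 + ε) ^ (N * N') :=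
      pow_le_pow_left₀ (by positivity) hηε _
    calc (v * v') ^ (N * N') = (v ^ N) ^ N' * (v' ^ N') ^ N := by
          rw [mul_pow, ← pow_mul, ← pow_mul, Nat.mul_comm N' N]
      _ ≤ ((1 + η) ^ N * ∑ i, ((k i * m i * n i : ℕ) : ℝ) ^ (ρ / 3)) ^ N' *
            ((1 + η) ^ N' * ∑ i, ((k' i * m' i * n' i : ℕ) : ℝ) ^ (ρ / 3)) ^ N :=
          mul_le_mul h1 h2 (pow_nonneg (pow_nonneg hv' N') N) (by positivity)
      _ = ((1 + η) * (1 + η)) ^ (N * N') *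
            ((∑ i, ((k i * m i * n i : ℕ) : ℝ) ^ (ρ / 3)) ^ N' *
              (∑ i, ((k' i * m' i * n' i : ℕ) : ℝ) ^ (ρ / 3)) ^ N) := by
          rw [mul_pow, mul_pow, mul_pow, ← pow_mul, ← pow_mul, Nat.mul_comm N' N]; ring
      _ ≤ (1 + ε) ^ (N * N') *
            ((∑ i, ((k i * m i * n i : ℕ) : ℝ) ^ (ρ / 3)) ^ N' *
              (∑ i, ((k' i * m' i * n' i : ℕ) : ℝ) ^ (ρ / 3)) ^ N) :=
          mul_le_mul_of_nonneg_right h3 (by positivity)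

/-- **`V_ρ(t^{⊗n}) ≥ w` ⇒ `V_ρ(t) ≥ w^{1/n}`** (`n ≥ 1`, `w ≥ 0`): a witness for `(t^{⊗n})^{⊗N}` is a
witness for `t^{⊗nN}`. [cite: LeGall2014, §2.2] -/
theorem HasLaserValue.of_kroneckerPow {ρ : ℝ} {t : ι → κ → μ → K} {w : ℝ} {n : ℕ} (hn : 1 ≤ n)
    (h : HasLaserValue ρ (kroneckerPow t n) w) (hw : 0 ≤ w) :
    HasLaserValue ρ t (w ^ ((n : ℝ)⁻¹)) := by
  classical
  intro ε hε
  obtain ⟨N, hN, p, k, m, n', hdeg, hb⟩ := h ε hε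
  refine ⟨N * n, Nat.one_le_iff_ne_zero.2 (Nat.mul_ne_zero (by omega) (by omega)), p, k, m, n',
    (tensorRestrictsTo_kroneckerPow_mul t N n).trans_polyDegeneratesTo hdeg, ?_⟩
  have hn0 : (n : ℝ) ≠ 0 := by exact_mod_cast (by omega : n ≠ 0)
  have h1 : (w ^ ((n : ℝ)⁻¹)) ^ (N * n) = w ^ N := by
    rw [Nat.mul_comm, pow_mul, ← Real.rpow_natCast (w ^ ((n : ℝ)⁻¹)) n, ← Real.rpow_mul hw,
      inv_mul_cancel₀ hn0, Real.rpow_one]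
  rw [h1]
  refine hb.trans (mul_le_mul_of_nonneg_right ?_ ?_)
  · exact pow_le_pow_right₀ (by linarith) (Nat.le_mul_of_pos_right N (by omega))
  · exact Finset.sum_nonneg fun i _ => Real.rpow_nonneg (Nat.cast_nonneg _) _

omit [DecidableEq ι] [DecidableEq κ] [DecidableEq μ] in
/-- **The value `≥ 0` is free**: `V_ρ(t) ≥ 0` (the empty direct sum). [folklore] -/
theorem hasLaserValue_zero (ρ : ℝ) (t : ι → κ → μ → K) : HasLaserValue ρ t 0 := by
  classical
  intro ε hε
  refine ⟨1, le_rfl, 0, Fin.elim0, Fin.elim0, Fin.elim0, ?_, ?_⟩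
  · exact TensorRestrictsTo.polyDegeneratesTo
      ⟨fun a _ => Fin.elim0 a.1, fun b _ => Fin.elim0 b.1, fun c _ => Fin.elim0 c.1,
        fun a => Fin.elim0 a.1⟩
  · simp

/-- **The empty Kronecker product has value `≥ 1`**: for a family indexed by `Fin 0`, `⊗_l T_l` is
the scalar `1` (`≅ ⟨1,1,1⟩`). [folklore] -/
theorem hasLaserValue_one_kroneckerPi_zero (ρ : ℝ) (T : Fin 0 → ι → κ → μ → K) :
    HasLaserValue ρ (kroneckerPi T) 1 := by
  classical
  have hdeg : PolyDegeneratesTo (kroneckerPow (kroneckerPi T) 1)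
      (matMulDirectSum K (fun _ : Fin 1 => 1) (fun _ => 1) (fun _ => 1)) := by
    refine TensorRestrictsTo.polyDegeneratesTo ?_
    have key : matMulDirectSum K (fun _ : Fin 1 => 1) (fun _ => 1) (fun _ => 1) = fun a b c =>
        kroneckerPow (kroneckerPi T) 1 (fun _ i => Fin.elim0 i) (fun _ i => Fin.elim0 i)
          (fun _ i => Fin.elim0 i) := by
      funext a b c
      obtain ⟨ja, x, z⟩ := a
      obtain ⟨jb, x', y⟩ := b
      obtain ⟨jc, y', z'⟩ := c
      have h1 := Fin.fin_one_eq_zero ja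
      have h2 := Fin.fin_one_eq_zero jb
      have h3 := Fin.fin_one_eq_zero jc
      subst h1 h2 h3
      simp [matMulDirectSum, Fin.val_eq_zero, kroneckerPow_apply, kroneckerPi_apply]
    rw [key]
    exact tensorRestrictsTo_precomp _ _ _ _
  have h := hasLaserValue_of_witness (ρ := ρ) (le_refl 1) hdeg
  simpa using h

/-- `⊗_{l < N+1} T_l ≥ T_0 ⊗ (⊗_{l < N} T_{l+1})` (relabelling along `Fin.cons`). [folklore] -/
theorem tensorRestrictsTo_kroneckerPi_succ {N : ℕ} (T : Fin (N + 1) → ι → κ → μ → K) :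
    TensorRestrictsTo (kroneckerPi T) (kroneckerTensor (T 0) (kroneckerPi fun l => T l.succ)) := by
  have key : kroneckerTensor (T 0) (kroneckerPi fun l => T l.succ) = fun a b c =>
      kroneckerPi T (Fin.cons a.1 a.2) (Fin.cons b.1 b.2) (Fin.cons c.1 c.2) := by
    funext a b c
    simp only [kroneckerTensor_apply, kroneckerPi_apply, Fin.prod_univ_succ, Fin.cons_zero,
      Fin.cons_succ]
  rw [key]
  exact tensorRestrictsTo_precomp _ _ _ _

/-- **`N`-ary supermultiplicativity**: if `V_ρ(T_l) ≥ v_l ≥ 0` for all `l < N` then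
`V_ρ(⊗_l T_l) ≥ ∏_l v_l` (induction on `N` with `HasLaserValue.kronecker`; this is the form in which
the laser method bounds the value of a block `⊗_ρ t(x_ρ,y_ρ,z_ρ)` of `t^{⊗N}`).
[cite: LeGall2014, §2.2 and proof of Thm. 4.1] -/
theorem HasLaserValue.kroneckerPi {ρ : ℝ} {N : ℕ} {T : Fin N → ι → κ → μ → K} {v : Fin N → ℝ}
    (h : ∀ l, HasLaserValue ρ (T l) (v l)) (hv : ∀ l, 0 ≤ v l) :
    HasLaserValue ρ (kroneckerPi T) (∏ l, v l) := by
  induction N with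
  | zero =>
    rw [Finset.univ_eq_empty, Finset.prod_empty]
    exact hasLaserValue_one_kroneckerPi_zero ρ T
  | succ N ih =>
    rw [Fin.prod_univ_succ]
    -- (`kroneckerPi` spelled out: inside `HasLaserValue.kroneckerPi` the short name is this lemma)
    have ih' : HasLaserValue ρ (Literature.Computability.AlgebraicComplexity.kroneckerPi fun l => T l.succ)
        (∏ l : Fin N, v l.succ) :=
      ih (fun l => h l.succ) (fun l => hv l.succ)
    exact ((h 0).kronecker ih' (hv 0) (Finset.prod_nonneg fun l _ => hv l.succ)).of_restrictsTo
      (tensorRestrictsTo_kroneckerPi_succ T)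

/-- **`V_ρ(t^{⊗n}) ≥ v^n`** for `V_ρ(t) ≥ v ≥ 0`. [cite: LeGall2014, §2.2] -/
theorem HasLaserValue.kroneckerPow {ρ : ℝ} {t : ι → κ → μ → K} {v : ℝ} (h : HasLaserValue ρ t v)
    (hv : 0 ≤ v) (n : ℕ) : HasLaserValue ρ (kroneckerPow t n) (v ^ n) := by
  have h1 := HasLaserValue.kroneckerPi (N := n) (T := fun _ => t) (v := fun _ => v) (fun _ => h)
    (fun _ => hv)
  rwa [Finset.prod_const, Finset.card_univ, Fintype.card_fin, ← kroneckerPow_eq_kroneckerPi] at h1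

end Products

/-! ## Closure under limits from below -/

section Limits

variable {K : Type u} [Field K]
variable {ι κ μ : Type*} [Fintype ι] [Fintype κ] [Fintype μ]

/-- **The value bound is closed**: if `V_ρ(t) ≥ v'` for every `0 ≤ v' < v` then `V_ρ(t) ≥ v`
(given `ε`, use the bound `v/(1+η)` at tolerance `η` with `(1+η)² ≤ 1+ε`). [folklore] -/
theorem hasLaserValue_of_forall_lt {ρ : ℝ} {t : ι → κ → μ → K} {v : ℝ}
    (h : ∀ v' : ℝ, 0 ≤ v' → v' < v → HasLaserValue ρ t v') : HasLaserValue ρ t v := by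
  rcases le_or_gt v 0 with hv | hv
  · -- `v ≤ 0`: `v^N ≤ 0^N`-type bounds do not hold for even `N`, but the witness of
    -- `hasLaserValue_zero` is at `N = 1`
    intro ε hε
    refine ⟨1, le_rfl, 0, Fin.elim0, Fin.elim0, Fin.elim0, ?_, ?_⟩
    · exact TensorRestrictsTo.polyDegeneratesTo
        ⟨fun a _ => Fin.elim0 a.1, fun b _ => Fin.elim0 b.1, fun c _ => Fin.elim0 c.1,
          fun a => Fin.elim0 a.1⟩
    · simpa using hv
  · intro ε hε
    obtain ⟨η, hη, -, hηε⟩ := exists_pos_mul_self_le_one_add hε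
    have hη1 : (0 : ℝ) < 1 + η := by linarith
    have hv' : v / (1 + η) < v := by
      rw [div_lt_iff₀ hη1]; nlinarith
    obtain ⟨N, hN, p, k, m, n, hdeg, hb⟩ := h (v / (1 + η)) (div_nonneg hv.le hη1.le) hv' η hη
    refine ⟨N, hN, p, k, m, n, hdeg, ?_⟩
    have hS : 0 ≤ ∑ i, ((k i * m i * n i : ℕ) : ℝ) ^ (ρ / 3) :=
      Finset.sum_nonneg fun i _ => Real.rpow_nonneg (Nat.cast_nonneg _) _
    have h1 : v ^ N = (1 + η) ^ N * (v / (1 + η)) ^ N := by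
      rw [← mul_pow, mul_div_cancel₀ _ hη1.ne']
    calc v ^ N = (1 + η) ^ N * (v / (1 + η)) ^ N := h1
      _ ≤ (1 + η) ^ N * ((1 + η) ^ N * ∑ i, ((k i * m i * n i : ℕ) : ℝ) ^ (ρ / 3)) :=
          mul_le_mul_of_nonneg_left hb (by positivity)
      _ = ((1 + η) * (1 + η)) ^ N * ∑ i, ((k i * m i * n i : ℕ) : ℝ) ^ (ρ / 3) := by
          rw [mul_pow]; ring
      _ ≤ (1 + ε) ^ N * ∑ i, ((k i * m i * n i : ℕ) : ℝ) ^ (ρ / 3) :=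
          mul_le_mul_of_nonneg_right (pow_le_pow_left₀ (by positivity) hηε N) hS

/-- Sequential form: if `V_ρ(t) ≥ f i` for all `i` and `f i → v` then `V_ρ(t) ≥ v`. [folklore] -/
theorem hasLaserValue_of_tendsto {ρ : ℝ} {t : ι → κ → μ → K} {v : ℝ} {f : ℕ → ℝ}
    (h : ∀ i, HasLaserValue ρ t (f i)) (hf : Tendsto f atTop (𝓝 v)) : HasLaserValue ρ t v := by
  refine hasLaserValue_of_forall_lt fun v' hv'0 hv'v => ?_
  obtain ⟨i, hi⟩ := (hf.eventually (Ioi_mem_nhds hv'v)).exists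
  exact (h i).mono hv'0 (le_of_lt hi)

end Limits

end Literature.Computability.AlgebraicComplexity
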